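import Summits.CriticalPhenomena.CardyFormulaZ2.Theorems.CardyComplexConeEdgePrecompactUFRSEvents

/-!
# Assembling strand families and certificate branches (tools for the UFRS arm domination)
(line `qkz-strip-boundary-arm` of crux `CardyComplexCone.EdgePrecompact`, stmt-CriticalPhenomena-11387;
deterministic assembly of the corrected item (H₁) `ufrs_armDomination2` of the road map for the
uniform forward response stability "UFRS", vocabulary of
`Theorems/CardyComplexConeEdgePrecompactUFRSEvents.lean`)

The certificate `ufrsCert E w z r R` of `…UFRSEvents.lean` is a union of events built from the
strand-crossing families `ufrsStrands E w z k r R` (`k` pairwise corner-disjoint simple orbit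
stretches of either dynamics joining the `r`-ball of `z` to distance `≥ R`). The case analysis
of `ufrs_armDomination2` produces, in each case, two or three EXPLICIT stretches (pieces of the
first stretch `S₀`, of the free part of the second run, of the return journey of the
exploration); this file turns such explicit data into memberships:

* `mem_ufrsStrands_two_W3H`, `mem_ufrsStrands_three_W3H` — constructors of `ufrsStrands … 2 …` and
  `ufrsStrands … 3 …` from explicit stretches with Boolean dynamics tags (the `if τ then … else …`
  of the definition is kept verbatim, so that at a literal tag it reduces definitionally);
* `ufrsStrands_mono_W3H` (shrinking the annulus keeps the crossings), `ufrsStrands_two_of_three_W3H`;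
* `exists_dyadic_scale_W3H` — a dyadic radius `R/2/2^k` in every window `(x/2, x]`, `0 < x ≤ R/2`;
* the branch constructors `mem_ufrsCert_of_lt_W3H` (escape), `mem_ufrsCertFar_of_strands_W3H` (three
  strands from the `r`-ball to distance `R/2` give the FAR branch: the inner scale is then
  automatic), `mem_ufrsCertNear_of_strands_W3H`, `mem_ufrsCertMarked_of_strands_W3H` (three strands of
  extent `≥ X` with a marked edge within `2X`, `32 r ≤ X < R/2`, and two strands to `R/2`), and
  the three embeddings into `ufrsCert`;
* in the UFRS normalisation `r = 4η`, `R = ρ/2`: `mem_ufrsCert_of_three_far_W3H` (three long strands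
  certify) and `mem_ufrsCert_of_two_far_and_marked_W3H` (two long strands, a marked edge within
  `X + E.δ`, and a third strand of extent `X` if the marked edge is not within `64 r`, certify);
  `ufrs_certOfThreeLongStrands` is the registered `∀`-form of the former.

References: S. Smirnov, C. R. Acad. Sci. Paris 333 (2001), §2; P. Nolin, Electron. J. Probab. 13
(2008), §4 (arm events in annuli, dyadic scales).
-/

namespace Summit.CriticalPhenomena.CardyFormulaZ2.Cruxes.EdgePrecompact.QkzStripBoundaryArm

open MeasureTheory Filter Set Metric
open scoped Topology BigOperators Pointwise
open Literature.Probability.LatticeModels Literature.Probability.Percolation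
open Literature.Probability.RandomPlanarGeometry (DobrushinDomain)
open Summit.CriticalPhenomena.CardyFormulaZ2.Theses.CardyComplexCone

noncomputable section

/-! ## Constructors of strand families -/

/-- **Two explicit strands give `ufrsStrands … 2 …`.** Each strand is a stretch `[iₐ, jₐ]` of the
orbit of `cₐ` under the dynamics tagged by `τₐ` (`E.bcBondConfig ω` if `τₐ`, the translate's
completion otherwise), through the corresponding inner faces, simple, joining the `r`-ball of
`z` to distance `≥ R` in either direction; the two stretches share no corner. -/
theorem mem_ufrsStrands_two_W3H {E : DiscreteDobrushin} {w : Site 2} {z : ℂ} {r R : ℝ} {ω : BondConfig (Site 2)}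
    (τ₁ τ₂ : Bool) (c₁ c₂ : Site 2 × Fin 4) (i₁ j₁ i₂ j₂ : ℕ)
    (h₁ : i₁ ≤ j₁ ∧ ((dist (meshPoint E.δ (cornerOrbit (if τ₁ then E.bcBondConfig ω else (shiftData E w).bcBondConfig ω) c₁ i₁).1) z ≤ r ∧ R ≤ dist (meshPoint E.δ (cornerOrbit (if τ₁ then E.bcBondConfig ω else (shiftData E w).bcBondConfig ω) c₁ j₁).1) z) ∨ (R ≤ dist (meshPoint E.δ (cornerOrbit (if τ₁ then E.bcBondConfig ω else (shiftData E w).bcBondConfig ω) c₁ i₁).1) z ∧ dist (meshPoint E.δ (cornerOrbit (if τ₁ then E.bcBondConfig ω else (shiftData E w).bcBondConfig ω) c₁ j₁).1) z ≤ r)) ∧ (∀ t, i₁ ≤ t → t ≤ j₁ → if τ₁ then E.IsInnerFace (cFace (cornerOrbit (if τ₁ then E.bcBondConfig ω else (shiftData E w).bcBondConfig ω) c₁ t)) else (shiftData E w).IsInnerFace (cFace (cornerOrbit (if τ₁ then E.bcBondConfig ω else (shiftData E w).bcBondConfig ω) c₁ t))) ∧ (∀ s t, i₁ ≤ s → s <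 t → t ≤ j₁ → cornerOrbit (if τ₁ then E.bcBondConfig ω else (shiftData E w).bcBondConfig ω) c₁ s ≠ cornerOrbit (if τ₁ then E.bcBondConfig ω else (shiftData E w).bcBondConfig ω) c₁ t))
    (h₂ : i₂ ≤ j₂ ∧ ((dist (meshPoint E.δ (cornerOrbit (if τ₂ then E.bcBondConfig ω else (shiftData E w).bcBondConfig ω) c₂ i₂).1) z ≤ r ∧ R ≤ dist (meshPoint E.δ (cornerOrbit (if τ₂ then E.bcBondConfig ω else (shiftData E w).bcBondConfig ω) c₂ j₂).1) z) ∨ (R ≤ dist (meshPoint E.δ (cornerOrbit (if τ₂ then E.bcBondConfig ω else (shiftData E w).bcBondConfig ω) c₂ i₂).1) z ∧ dist (meshPoint E.δ (cornerOrbit (if τ₂ then E.bcBondConfig ω else (shiftData E w).bcBondConfig ω) c₂ j₂).1) z ≤ r)) ∧ (∀ t, i₂ ≤ t → t ≤ j₂ → if τ₂ then E.IsInnerFace (cFace (cornerOrbit (if τ₂ then E.bcBondConfig ω else (shiftData E w).bcBondConfig ω) c₂ t)) else (shiftData E w).IsInnerFace (cFace (cornerOrbit (if τ₂ then E.bcBondConfig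 ω else (shiftData E w).bcBondConfig ω) c₂ t))) ∧ (∀ s t, i₂ ≤ s → s < t → t ≤ j₂ → cornerOrbit (if τ₂ then E.bcBondConfig ω else (shiftData E w).bcBondConfig ω) c₂ s ≠ cornerOrbit (if τ₂ then E.bcBondConfig ω else (shiftData E w).bcBondConfig ω) c₂ t))
    (h₁₂ : ∀ s t, i₁ ≤ s → s ≤ j₁ → i₂ ≤ t → t ≤ j₂ → cornerOrbit (if τ₁ then E.bcBondConfig ω else (shiftData E w).bcBondConfig ω) c₁ s ≠ cornerOrbit (if τ₂ then E.bcBondConfig ω else (shiftData E w).bcBondConfig ω) c₂ t) :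
    ω ∈ ufrsStrands E w z 2 r R := by
  rw [mem_ufrsStrands_iff]
  refine ⟨![c₁, c₂], ![i₁, i₂], ![j₁, j₂], ![τ₁, τ₂], fun a => ?_, fun a b hab => ?_⟩
  · fin_cases a
    · exact h₁
    · exact h₂
  · fin_cases a <;> fin_cases b
    · exact absurd rfl hab
    · exact h₁₂
    · intro s t hs hsj ht htj h
      exact h₁₂ t s ht htj hs hsj h.symm
    · exact absurd rfl hab

/-- **Three explicit strands give `ufrsStrands … 3 …`** (same format as `mem_ufrsStrands_two_W3H`,
with the three pairwise disjointness hypotheses). -/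
theorem mem_ufrsStrands_three_W3H {E : DiscreteDobrushin} {w : Site 2} {z : ℂ} {r R : ℝ} {ω : BondConfig (Site 2)}
    (τ₁ τ₂ τ₃ : Bool) (c₁ c₂ c₃ : Site 2 × Fin 4) (i₁ j₁ i₂ j₂ i₃ j₃ : ℕ)
    (h₁ : i₁ ≤ j₁ ∧ ((dist (meshPoint E.δ (cornerOrbit (if τ₁ then E.bcBondConfig ω else (shiftData E w).bcBondConfig ω) c₁ i₁).1) z ≤ r ∧ R ≤ dist (meshPoint E.δ (cornerOrbit (if τ₁ then E.bcBondConfig ω else (shiftData E w).bcBondConfig ω) c₁ j₁).1) z) ∨ (R ≤ dist (meshPoint E.δ (cornerOrbit (if τ₁ then E.bcBondConfig ω else (shiftData E w).bcBondConfig ω) c₁ i₁).1) z ∧ dist (meshPoint E.δ (cornerOrbit (if τ₁ then E.bcBondConfig ω else (shiftData E w).bcBondConfig ω) c₁ j₁).1) z ≤ r)) ∧ (∀ t, i₁ ≤ t → t ≤ j₁ → if τ₁ then E.IsInnerFace (cFace (cornerOrbit (if τ₁ then E.bcBondConfig ω else (shiftData E w).bcBondConfig ω) c₁ t)) else (shiftData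 E w).IsInnerFace (cFace (cornerOrbit (if τ₁ then E.bcBondConfig ω else (shiftData E w).bcBondConfig ω) c₁ t))) ∧ (∀ s t, i₁ ≤ s → s < t → t ≤ j₁ → cornerOrbit (if τ₁ then E.bcBondConfig ω else (shiftData E w).bcBondConfig ω) c₁ s ≠ cornerOrbit (if τ₁ then E.bcBondConfig ω else (shiftData E w).bcBondConfig ω) c₁ t))
    (h₂ : i₂ ≤ j₂ ∧ ((dist (meshPoint E.δ (cornerOrbit (if τ₂ then E.bcBondConfig ω else (shiftData E w).bcBondConfig ω) c₂ i₂).1) z ≤ r ∧ R ≤ dist (meshPoint E.δ (cornerOrbit (if τ₂ then E.bcBondConfig ω else (shiftData E w).bcBondConfig ω) c₂ j₂).1) z) ∨ (R ≤ dist (meshPoint E.δ (cornerOrbit (if τ₂ then E.bcBondConfig ω else (shiftData E w).bcBondConfig ω) c₂ i₂).1) z ∧ dist (meshPoint E.δ (cornerOrbit (if τ₂ then E.bcBondConfig ω else (shiftData E w).bcBondConfig ω) c₂ j₂).1) z ≤ r)) ∧ (∀ t, i₂ ≤ t → t ≤ j₂ → if τ₂ then E.IsInnerFace (cFace (cornerOrbit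 (if τ₂ then E.bcBondConfig ω else (shiftData E w).bcBondConfig ω) c₂ t)) else (shiftData E w).IsInnerFace (cFace (cornerOrbit (if τ₂ then E.bcBondConfig ω else (shiftData E w).bcBondConfig ω) c₂ t))) ∧ (∀ s t, i₂ ≤ s → s < t → t ≤ j₂ → cornerOrbit (if τ₂ then E.bcBondConfig ω else (shiftData E w).bcBondConfig ω) c₂ s ≠ cornerOrbit (if τ₂ then E.bcBondConfig ω else (shiftData E w).bcBondConfig ω) c₂ t))
    (h₃ : i₃ ≤ j₃ ∧ ((dist (meshPoint E.δ (cornerOrbit (if τ₃ then E.bcBondConfig ω else (shiftData E w).bcBondConfig ω) c₃ i₃).1) z ≤ r ∧ R ≤ dist (meshPoint E.δ (cornerOrbit (if τ₃ then E.bcBondConfig ω else (shiftData E w).bcBondConfig ω) c₃ j₃).1) z) ∨ (R ≤ dist (meshPoint E.δ (cornerOrbit (if τ₃ then E.bcBondConfig ω else (shiftData E w).bcBondConfig ω) c₃ i₃).1) z ∧ dist (meshPoint E.δ (cornerOrbit (if τ₃ then E.bcBondConfig ω else (shiftData E w).bcBondConfig ω) c₃ j₃).1) z ≤ r)) ∧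 (∀ t, i₃ ≤ t → t ≤ j₃ → if τ₃ then E.IsInnerFace (cFace (cornerOrbit (if τ₃ then E.bcBondConfig ω else (shiftData E w).bcBondConfig ω) c₃ t)) else (shiftData E w).IsInnerFace (cFace (cornerOrbit (if τ₃ then E.bcBondConfig ω else (shiftData E w).bcBondConfig ω) c₃ t))) ∧ (∀ s t, i₃ ≤ s → s < t → t ≤ j₃ → cornerOrbit (if τ₃ then E.bcBondConfig ω else (shiftData E w).bcBondConfig ω) c₃ s ≠ cornerOrbit (if τ₃ then E.bcBondConfig ω else (shiftData E w).bcBondConfig ω) c₃ t))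
    (h₁₂ : ∀ s t, i₁ ≤ s → s ≤ j₁ → i₂ ≤ t → t ≤ j₂ → cornerOrbit (if τ₁ then E.bcBondConfig ω else (shiftData E w).bcBondConfig ω) c₁ s ≠ cornerOrbit (if τ₂ then E.bcBondConfig ω else (shiftData E w).bcBondConfig ω) c₂ t)
    (h₁₃ : ∀ s t, i₁ ≤ s → s ≤ j₁ → i₃ ≤ t → t ≤ j₃ → cornerOrbit (if τ₁ then E.bcBondConfig ω else (shiftData E w).bcBondConfig ω) c₁ s ≠ cornerOrbit (if τ₃ then E.bcBondConfig ω else (shiftData E w).bcBondConfig ω) c₃ t)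
    (h₂₃ : ∀ s t, i₂ ≤ s → s ≤ j₂ → i₃ ≤ t → t ≤ j₃ → cornerOrbit (if τ₂ then E.bcBondConfig ω else (shiftData E w).bcBondConfig ω) c₂ s ≠ cornerOrbit (if τ₃ then E.bcBondConfig ω else (shiftData E w).bcBondConfig ω) c₃ t) :
    ω ∈ ufrsStrands E w z 3 r R := by
  rw [mem_ufrsStrands_iff]
  refine ⟨![c₁, c₂, c₃], ![i₁, i₂, i₃], ![j₁, j₂, j₃], ![τ₁, τ₂, τ₃], fun a => ?_, fun a b hab => ?_⟩
  · fin_cases a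
    · exact h₁
    · exact h₂
    · exact h₃
  · fin_cases a <;> fin_cases b
    · exact absurd rfl hab
    · exact h₁₂
    · exact h₁₃
    · intro s t hs hsj ht htj h
      exact h₁₂ t s ht htj hs hsj h.symm
    · exact absurd rfl hab
    · exact h₂₃
    · intro s t hs hsj ht htj h
      exact h₁₃ t s ht htj hs hsj h.symm
    · intro s t hs hsj ht htj h
      exact h₂₃ t s ht htj hs hsj h.symm
    · exact absurd rfl hab

/-! ## Monotonicity in the annulus and in the number of strands -/

/-- **Shrinking the annulus keeps the crossings**: `ufrsStrands` is monotone in the inner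
radius and antitone in the outer radius. -/
theorem ufrsStrands_mono_W3H {E : DiscreteDobrushin} {w : Site 2} {z : ℂ} {k : ℕ} {r r' R R' : ℝ}
    (hr : r ≤ r') (hR : R' ≤ R) : ufrsStrands E w z k r R ⊆ ufrsStrands E w z k r' R' := by
  intro ω hω
  rw [mem_ufrsStrands_iff] at hω ⊢
  obtain ⟨c, i, j, τ, hstr, hdisj⟩ := hω
  refine ⟨c, i, j, τ, fun a => ?_, hdisj⟩
  obtain ⟨hij, hends, hface, hsimple⟩ := hstr a
  refine ⟨hij, ?_, hface, hsimple⟩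
  rcases hends with ⟨h1, h2⟩ | ⟨h1, h2⟩
  · exact Or.inl ⟨h1.trans hr, hR.trans h2⟩
  · exact Or.inr ⟨hR.trans h1, h2.trans hr⟩

/-- Three strand-crossings contain two. -/
theorem ufrsStrands_two_of_three_W3H {E : DiscreteDobrushin} {w : Site 2} {z : ℂ} {r R : ℝ} :
    ufrsStrands E w z 3 r R ⊆ ufrsStrands E w z 2 r R := by
  intro ω hω
  rw [mem_ufrsStrands_iff] at hω ⊢
  obtain ⟨c, i, j, τ, hstr, hdisj⟩ := hω
  refine ⟨fun a => c (Fin.castSucc a), fun a => i (Fin.castSucc a), fun a => j (Fin.castSucc a),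
    fun a => τ (Fin.castSucc a), fun a => hstr (Fin.castSucc a), fun a b hab => ?_⟩
  exact hdisj (Fin.castSucc a) (Fin.castSucc b) (fun h => hab (Fin.castSucc_injective _ h))

/-! ## Dyadic scales -/

/-- **A dyadic radius in every window.** For `0 < x ≤ R/2` there is `k` with
`x/2 < R/2/2^k ≤ x`. -/
theorem exists_dyadic_scale_W3H {R x : ℝ} (hx : 0 < x) (hxR : x ≤ R / 2) :
    ∃ k : ℕ, x / 2 < R / 2 / 2 ^ k ∧ R / 2 / 2 ^ k ≤ x := by
  classical
  have hR : 0 < R / 2 := lt_of_lt_of_le hx hxR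
  -- some power of two brings `R/2` below `x`
  have hex : ∃ k : ℕ, R / 2 / 2 ^ k ≤ x := by
    obtain ⟨k, hk⟩ := pow_unbounded_of_one_lt (R / 2 / x) (by norm_num : (1:ℝ) < 2)
    refine ⟨k, ?_⟩
    rw [div_le_iff₀ (by positivity)]
    have := (div_lt_iff₀ hx).1 hk
    linarith
  refine ⟨Nat.find hex, ?_, Nat.find_spec hex⟩
  rcases Nat.eq_zero_or_pos (Nat.find hex) with h0 | hpos
  · rw [h0, pow_zero, div_one]
    linarith
  · obtain ⟨m, hm⟩ : ∃ m, Nat.find hex = m + 1 := ⟨Nat.find hex - 1, by omega⟩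
    have hmin : ¬ R / 2 / 2 ^ m ≤ x := Nat.find_min hex (by omega)
    rw [not_le] at hmin
    rw [hm, pow_succ, ← div_div]
    linarith

/-! ## Constructors of the certificate branches -/

/-- **Escape**: if `R < 256 r` every configuration is certified at `z`. -/
theorem mem_ufrsCert_of_lt_W3H {E : DiscreteDobrushin} {w : Site 2} {z : ℂ} {r R : ℝ} {ω : BondConfig (Site 2)}
    (h : R < 256 * r) : ω ∈ ufrsCert E w z r R := by
  rw [mem_ufrsCert_iff]
  exact Or.inl (Or.inl (Or.inl h))

/-- The FAR branch certifies. -/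
theorem mem_ufrsCert_of_far_W3H {E : DiscreteDobrushin} {w : Site 2} {z : ℂ} {r R : ℝ} {ω : BondConfig (Site 2)}
    (h : ω ∈ ufrsCertFar E w z r R) : ω ∈ ufrsCert E w z r R := by
  rw [mem_ufrsCert_iff]
  exact Or.inl (Or.inl (Or.inr h))

/-- The MARKED branch certifies. -/
theorem mem_ufrsCert_of_marked_W3H {E : DiscreteDobrushin} {w : Site 2} {z : ℂ} {r R : ℝ} {ω : BondConfig (Site 2)}
    (h : ω ∈ ufrsCertMarked E w z r R) : ω ∈ ufrsCert E w z r R := by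
  rw [mem_ufrsCert_iff]
  exact Or.inl (Or.inr h)

/-- The NEAR branch certifies. -/
theorem mem_ufrsCert_of_near_W3H {E : DiscreteDobrushin} {w : Site 2} {z : ℂ} {r R : ℝ} {ω : BondConfig (Site 2)}
    (h : ω ∈ ufrsCertNear E w z r R) : ω ∈ ufrsCert E w z r R := by
  rw [mem_ufrsCert_iff]
  exact Or.inr h

/-- **FAR from three long strands.** Three strand-crossings from the `r`-ball of `z` to distance
`R/2` give the FAR branch (`0 < r`, `64 r ≤ R`): with the dyadic `d ∈ (r, 2r]` both the inner
family (across `A(z; r, d/2)`) and the outer family (across `A(z; 2d, R/2)`) are the given one,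
by monotonicity. -/
theorem mem_ufrsCertFar_of_strands_W3H {E : DiscreteDobrushin} {w : Site 2} {z : ℂ} {r R : ℝ} {ω : BondConfig (Site 2)}
    (hr : 0 < r) (hrR : 64 * r ≤ R) (h : ω ∈ ufrsStrands E w z 3 r (R / 2)) :
    ω ∈ ufrsCertFar E w z r R := by
  obtain ⟨k, hk1, hk2⟩ := exists_dyadic_scale_W3H (R := R) (x := 2 * r) (by positivity) (by linarith)
  rw [mem_ufrsCertFar_iff]
  refine ⟨R / 2 / 2 ^ k, ⟨k, rfl⟩, by linarith, by linarith, fun _ => ?_, ?_⟩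
  · exact ufrsStrands_mono_W3H le_rfl (by linarith) h
  · exact ufrsStrands_mono_W3H (by linarith) le_rfl h

/-- **NEAR from a marked edge and two long strands** (the definition, repackaged). -/
theorem mem_ufrsCertNear_of_strands_W3H {E : DiscreteDobrushin} {w : Site 2} {z : ℂ} {r R : ℝ} {ω : BondConfig (Site 2)}
    (hz : z ∈ ufrsMarkedNbhd E w (64 * r)) (h : ω ∈ ufrsStrands E w z 2 (128 * r) (R / 2)) :
    ω ∈ ufrsCertNear E w z r R := by
  rw [mem_ufrsCertNear_iff]
  exact ⟨hz, h⟩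

/-- **MARKED from three strands of extent `X`, a marked edge within `2X`, and two long
strands** (`0 < r`, `32 r ≤ X < R/2`): take the dyadic `d ∈ (r, 2r]` and the dyadic
`R' ∈ (X/2, X]`; then `R' = R/2/2^(k+1)` since `R' < R/2`, the marked edge is within `2X < 4R'`,
`16 d ≤ R'` (both are dyadic fractions of `R/2` and `R'/8 > 2r ≥ d`), and all strand families
are the given ones by monotonicity. -/
theorem mem_ufrsCertMarked_of_strands_W3H {E : DiscreteDobrushin} {w : Site 2} {z : ℂ} {r R X : ℝ} {ω : BondConfig (Site 2)}
    (hr : 0 < r) (hrX : 32 * r ≤ X) (hXR : X < R / 2) (hz : z ∈ ufrsMarkedNbhd E w (2 * X))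
    (h3 : ω ∈ ufrsStrands E w z 3 r X) (h2 : ω ∈ ufrsStrands E w z 2 r (R / 2)) :
    ω ∈ ufrsCertMarked E w z r R := by
  have hX : 0 < X := by linarith
  have hR : 0 < R / 2 := by linarith
  obtain ⟨b, hb1, hb2⟩ := exists_dyadic_scale_W3H (R := R) (x := 2 * r) (by positivity) (by linarith)
  obtain ⟨k', hk'1, hk'2⟩ := exists_dyadic_scale_W3H (R := R) (x := X) hX hXR.le
  -- `R' < R/2` forces `k' ≥ 1`
  have hk'pos : k' ≠ 0 := by
    rintro rfl
    rw [pow_zero, div_one] at hk'2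
    linarith
  obtain ⟨a, rfl⟩ : ∃ a, k' = a + 1 := ⟨k' - 1, by omega⟩
  -- the two scales are separated by a factor `16`
  have h16 : 16 * (R / 2 / 2 ^ b) ≤ R / 2 / 2 ^ (a + 1) := by
    rcases le_or_gt (a + 1 + 4) b with h | h
    · have hpow : (2:ℝ) ^ (a + 1 + 4) ≤ 2 ^ b := pow_le_pow_right₀ (by norm_num) h
      have hle : R / 2 / 2 ^ b ≤ R / 2 / 2 ^ (a + 1 + 4) :=
        div_le_div_of_nonneg_left hR.le (by positivity) hpow
      have heq : R / 2 / 2 ^ (a + 1 + 4) = R / 2 / 2 ^ (a + 1) / 16 := by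
        rw [pow_add, ← div_div]; norm_num
      rw [heq] at hle
      linarith
    · exfalso
      have hpow : (2:ℝ) ^ b ≤ 2 ^ (a + 1 + 3) := pow_le_pow_right₀ (by norm_num) (by omega)
      have hle : R / 2 / 2 ^ (a + 1 + 3) ≤ R / 2 / 2 ^ b :=
        div_le_div_of_nonneg_left hR.le (by positivity) hpow
      have heq : R / 2 / 2 ^ (a + 1 + 3) = R / 2 / 2 ^ (a + 1) / 8 := by
        rw [pow_add, ← div_div]; norm_num
      rw [heq] at hle
      linarith
  rw [mem_ufrsCertMarked_iff]
  refine ⟨R / 2 / 2 ^ b, R / 2 / 2 ^ (a + 1), ⟨b, rfl⟩, ⟨a, rfl⟩, by linarith, h16,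
    fun _ => ?_, ?_, ?_, ?_⟩
  · exact ufrsStrands_mono_W3H le_rfl (by linarith) h3
  · exact ufrsStrands_mono_W3H (by linarith) hk'2 h3
  · rw [mem_ufrsMarkedNbhd_iff] at hz ⊢
    obtain ⟨e₀, he₀, hd⟩ := hz
    exact ⟨e₀, he₀, by linarith⟩
  · exact ufrsStrands_mono_W3H (by linarith) le_rfl h2

/-! ## One-line certificates from explicit strands (UFRS radii `r = 4η`, `R = ρ/2`) -/

/-- **Three long strands certify (FAR).** In the UFRS normalisation `r = 4η`, `R = ρ/2`,
outside the escape regime (`256 · 4η ≤ ρ/2`): three pairwise corner-disjoint strands from the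
`4η`-ball of `z` to distance `ρ/4` give `ω ∈ ufrsCert E w z (4η) (ρ/2)`. -/
theorem mem_ufrsCert_of_three_far_W3H {E : DiscreteDobrushin} {w : Site 2} {z : ℂ} {η ρ : ℝ} {ω : BondConfig (Site 2)}
    (τ₁ τ₂ τ₃ : Bool) (c₁ c₂ c₃ : Site 2 × Fin 4) (i₁ j₁ i₂ j₂ i₃ j₃ : ℕ) (hη : 0 < η) (hρ : 256 * (4 * η) ≤ ρ / 2)
    (h₁ : i₁ ≤ j₁ ∧ ((dist (meshPoint E.δ (cornerOrbit (if τ₁ then E.bcBondConfig ω else (shiftData E w).bcBondConfig ω) c₁ i₁).1) z ≤ (4 * η) ∧ (ρ / 2 / 2) ≤ dist (meshPoint E.δ (cornerOrbit (if τ₁ then E.bcBondConfig ω else (shiftData E w).bcBondConfig ω) c₁ j₁).1) z) ∨ ((ρ / 2 / 2) ≤ dist (meshPoint E.δ (cornerOrbit (if τ₁ then E.bcBondConfig ω else (shiftData E w).bcBondConfig ω) c₁ i₁).1) z ∧ dist (meshPoint E.δ (cornerOrbit (if τ₁ then E.bcBondConfig ω else (shiftData E w).bcBondConfig ω) c₁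 j₁).1) z ≤ (4 * η))) ∧ (∀ t, i₁ ≤ t → t ≤ j₁ → if τ₁ then E.IsInnerFace (cFace (cornerOrbit (if τ₁ then E.bcBondConfig ω else (shiftData E w).bcBondConfig ω) c₁ t)) else (shiftData E w).IsInnerFace (cFace (cornerOrbit (if τ₁ then E.bcBondConfig ω else (shiftData E w).bcBondConfig ω) c₁ t))) ∧ (∀ s t, i₁ ≤ s → s < t → t ≤ j₁ → cornerOrbit (if τ₁ then E.bcBondConfig ω else (shiftData E w).bcBondConfig ω) c₁ s ≠ cornerOrbit (if τ₁ then E.bcBondConfig ω else (shiftData E w).bcBondConfig ω) c₁ t))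
    (h₂ : i₂ ≤ j₂ ∧ ((dist (meshPoint E.δ (cornerOrbit (if τ₂ then E.bcBondConfig ω else (shiftData E w).bcBondConfig ω) c₂ i₂).1) z ≤ (4 * η) ∧ (ρ / 2 / 2) ≤ dist (meshPoint E.δ (cornerOrbit (if τ₂ then E.bcBondConfig ω else (shiftData E w).bcBondConfig ω) c₂ j₂).1) z) ∨ ((ρ / 2 / 2) ≤ dist (meshPoint E.δ (cornerOrbit (if τ₂ then E.bcBondConfig ω else (shiftData E w).bcBondConfig ω) c₂ i₂).1) z ∧ dist (meshPoint E.δ (cornerOrbit (if τ₂ then E.bcBondConfig ω else (shiftData E w).bcBondConfig ω) c₂ j₂).1) z ≤ (4 * η))) ∧ (∀ t, i₂ ≤ t → t ≤ j₂ → if τ₂ then E.IsInnerFace (cFace (cornerOrbit (if τ₂ then E.bcBondConfig ω else (shiftData E w).bcBondConfig ω) c₂ t)) else (shiftData E w).IsInnerFace (cFace (cornerOrbit (if τ₂ then E.bcBondConfig ω else (shiftData E w).bcBondConfig ω) c₂ t))) ∧ (∀ s t, i₂ ≤ s → s < t → t ≤ j₂ → cornerOrbit (if τ₂ then E.bcBondConfig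 ω else (shiftData E w).bcBondConfig ω) c₂ s ≠ cornerOrbit (if τ₂ then E.bcBondConfig ω else (shiftData E w).bcBondConfig ω) c₂ t))
    (h₃ : i₃ ≤ j₃ ∧ ((dist (meshPoint E.δ (cornerOrbit (if τ₃ then E.bcBondConfig ω else (shiftData E w).bcBondConfig ω) c₃ i₃).1) z ≤ (4 * η) ∧ (ρ / 2 / 2) ≤ dist (meshPoint E.δ (cornerOrbit (if τ₃ then E.bcBondConfig ω else (shiftData E w).bcBondConfig ω) c₃ j₃).1) z) ∨ ((ρ / 2 / 2) ≤ dist (meshPoint E.δ (cornerOrbit (if τ₃ then E.bcBondConfig ω else (shiftData E w).bcBondConfig ω) c₃ i₃).1) z ∧ dist (meshPoint E.δ (cornerOrbit (if τ₃ then E.bcBondConfig ω else (shiftData E w).bcBondConfig ω) c₃ j₃).1) z ≤ (4 * η))) ∧ (∀ t, i₃ ≤ t → t ≤ j₃ → if τ₃ then E.IsInnerFace (cFace (cornerOrbit (if τ₃ then E.bcBondConfig ω else (shiftData E w).bcBondConfig ω) c₃ t)) else (shiftData E w).IsInnerFace (cFace (cornerOrbit (if τ₃ then E.bcBondConfig ω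 else (shiftData E w).bcBondConfig ω) c₃ t))) ∧ (∀ s t, i₃ ≤ s → s < t → t ≤ j₃ → cornerOrbit (if τ₃ then E.bcBondConfig ω else (shiftData E w).bcBondConfig ω) c₃ s ≠ cornerOrbit (if τ₃ then E.bcBondConfig ω else (shiftData E w).bcBondConfig ω) c₃ t))
    (h₁₂ : ∀ s t, i₁ ≤ s → s ≤ j₁ → i₂ ≤ t → t ≤ j₂ → cornerOrbit (if τ₁ then E.bcBondConfig ω else (shiftData E w).bcBondConfig ω) c₁ s ≠ cornerOrbit (if τ₂ then E.bcBondConfig ω else (shiftData E w).bcBondConfig ω) c₂ t)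
    (h₁₃ : ∀ s t, i₁ ≤ s → s ≤ j₁ → i₃ ≤ t → t ≤ j₃ → cornerOrbit (if τ₁ then E.bcBondConfig ω else (shiftData E w).bcBondConfig ω) c₁ s ≠ cornerOrbit (if τ₃ then E.bcBondConfig ω else (shiftData E w).bcBondConfig ω) c₃ t)
    (h₂₃ : ∀ s t, i₂ ≤ s → s ≤ j₂ → i₃ ≤ t → t ≤ j₃ → cornerOrbit (if τ₂ then E.bcBondConfig ω else (shiftData E w).bcBondConfig ω) c₂ s ≠ cornerOrbit (if τ₃ then E.bcBondConfig ω else (shiftData E w).bcBondConfig ω) c₃ t) :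
    ω ∈ ufrsCert E w z (4 * η) (ρ / 2) :=
  mem_ufrsCert_of_far_W3H (mem_ufrsCertFar_of_strands_W3H (by positivity) (by linarith)
    (mem_ufrsStrands_three_W3H τ₁ τ₂ τ₃ c₁ c₂ c₃ i₁ j₁ i₂ j₂ i₃ j₃ h₁ h₂ h₃ h₁₂ h₁₃ h₂₃))

/-- **Two long strands, a marked edge, and (if the marked edge is not very close) a third
strand reaching it certify (NEAR or MARKED).** UFRS normalisation, `E.δ ≤ η`: two corner-disjoint strands from the `4η`-ball of `z` to every distance `R' ≤ ρ/4`,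
a marked edge (an `A`–`B` edge of `E` or of `shiftData E w`) within `X + E.δ` of `z` where
`X < ρ/4`, and, in case `64 · 4η < X + E.δ`, a third strand from the `4η`-ball to distance `X`
disjoint from the first two, give `ω ∈ ufrsCert E w z (4η) (ρ/2)`: the NEAR branch if
`X + E.δ ≤ 64 · 4η`, the MARKED branch (`mem_ufrsCertMarked_of_strands_W3H`) otherwise
(`E.δ ≤ η`). -/
theorem mem_ufrsCert_of_two_far_and_marked_W3H {E : DiscreteDobrushin} {w : Site 2} {z : ℂ} {η ρ X : ℝ} {ω : BondConfig (Site 2)}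
    (τ₁ τ₂ τ₃ : Bool) (c₁ c₂ c₃ : Site 2 × Fin 4) (i₁ j₁ i₂ j₂ i₃ j₃ : ℕ) (hη : 0 < η) (hδη : E.δ ≤ η)
    (hX : X < ρ / 2 / 2)
    (hmarked : ∃ e₀ : Sym2 (Site 2), (e₀ ∈ E.zdABEdges ∨ e₀ ∈ (shiftData E w).zdABEdges) ∧ dist (medialPoint E.δ e₀) z ≤ X + E.δ)
    (h₁ : ∀ R' : ℝ, R' ≤ ρ / 2 / 2 → i₁ ≤ j₁ ∧ ((dist (meshPoint E.δ (cornerOrbit (if τ₁ then E.bcBondConfig ω else (shiftData E w).bcBondConfig ω) c₁ i₁).1) z ≤ (4 * η) ∧ R' ≤ dist (meshPoint E.δ (cornerOrbit (if τ₁ then E.bcBondConfig ω else (shiftData E w).bcBondConfig ω) c₁ j₁).1) z) ∨ (R' ≤ dist (meshPoint E.δ (cornerOrbit (if τ₁ then E.bcBondConfig ω else (shiftData E w).bcBondConfig ω) c₁ i₁).1) z ∧ dist (meshPoint E.δ (cornerOrbit (if τ₁ then E.bcBondConfig ω else (shiftData E w).bcBondConfig ω) c₁ j₁).1) z ≤ (4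 * η))) ∧ (∀ t, i₁ ≤ t → t ≤ j₁ → if τ₁ then E.IsInnerFace (cFace (cornerOrbit (if τ₁ then E.bcBondConfig ω else (shiftData E w).bcBondConfig ω) c₁ t)) else (shiftData E w).IsInnerFace (cFace (cornerOrbit (if τ₁ then E.bcBondConfig ω else (shiftData E w).bcBondConfig ω) c₁ t))) ∧ (∀ s t, i₁ ≤ s → s < t → t ≤ j₁ → cornerOrbit (if τ₁ then E.bcBondConfig ω else (shiftData E w).bcBondConfig ω) c₁ s ≠ cornerOrbit (if τ₁ then E.bcBondConfig ω else (shiftData E w).bcBondConfig ω) c₁ t))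
    (h₂ : ∀ R' : ℝ, R' ≤ ρ / 2 / 2 → i₂ ≤ j₂ ∧ ((dist (meshPoint E.δ (cornerOrbit (if τ₂ then E.bcBondConfig ω else (shiftData E w).bcBondConfig ω) c₂ i₂).1) z ≤ (4 * η) ∧ R' ≤ dist (meshPoint E.δ (cornerOrbit (if τ₂ then E.bcBondConfig ω else (shiftData E w).bcBondConfig ω) c₂ j₂).1) z) ∨ (R' ≤ dist (meshPoint E.δ (cornerOrbit (if τ₂ then E.bcBondConfig ω else (shiftData E w).bcBondConfig ω) c₂ i₂).1) z ∧ dist (meshPoint E.δ (cornerOrbit (if τ₂ then E.bcBondConfig ω else (shiftData E w).bcBondConfig ω) c₂ j₂).1) z ≤ (4 * η))) ∧ (∀ t, i₂ ≤ t → t ≤ j₂ → if τ₂ then E.IsInnerFace (cFace (cornerOrbit (if τ₂ then E.bcBondConfig ω else (shiftData E w).bcBondConfig ω) c₂ t)) else (shiftData E w).IsInnerFace (cFace (cornerOrbit (if τ₂ then E.bcBondConfig ω else (shiftData E w).bcBondConfig ω) c₂ t))) ∧ (∀ s t, i₂ ≤ s → s < t → t ≤ j₂ → cornerOrbit (if τ₂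 then E.bcBondConfig ω else (shiftData E w).bcBondConfig ω) c₂ s ≠ cornerOrbit (if τ₂ then E.bcBondConfig ω else (shiftData E w).bcBondConfig ω) c₂ t))
    (h₁₂ : ∀ s t, i₁ ≤ s → s ≤ j₁ → i₂ ≤ t → t ≤ j₂ → cornerOrbit (if τ₁ then E.bcBondConfig ω else (shiftData E w).bcBondConfig ω) c₁ s ≠ cornerOrbit (if τ₂ then E.bcBondConfig ω else (shiftData E w).bcBondConfig ω) c₂ t)
    (h₃ : 64 * (4 * η) < X + E.δ → (i₃ ≤ j₃ ∧ ((dist (meshPoint E.δ (cornerOrbit (if τ₃ then E.bcBondConfig ω else (shiftData E w).bcBondConfig ω) c₃ i₃).1) z ≤ (4 * η) ∧ X ≤ dist (meshPoint E.δ (cornerOrbit (if τ₃ then E.bcBondConfig ω else (shiftData E w).bcBondConfig ω) c₃ j₃).1) z) ∨ (X ≤ dist (meshPoint E.δ (cornerOrbit (if τ₃ then E.bcBondConfig ω else (shiftData E w).bcBondConfig ω) c₃ i₃).1) z ∧ dist (meshPoint E.δ (cornerOrbit (if τ₃ then E.bcBondConfig ω else (shiftData E w).bcBondConfig ω) c₃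 j₃).1) z ≤ (4 * η))) ∧ (∀ t, i₃ ≤ t → t ≤ j₃ → if τ₃ then E.IsInnerFace (cFace (cornerOrbit (if τ₃ then E.bcBondConfig ω else (shiftData E w).bcBondConfig ω) c₃ t)) else (shiftData E w).IsInnerFace (cFace (cornerOrbit (if τ₃ then E.bcBondConfig ω else (shiftData E w).bcBondConfig ω) c₃ t))) ∧ (∀ s t, i₃ ≤ s → s < t → t ≤ j₃ → cornerOrbit (if τ₃ then E.bcBondConfig ω else (shiftData E w).bcBondConfig ω) c₃ s ≠ cornerOrbit (if τ₃ then E.bcBondConfig ω else (shiftData E w).bcBondConfig ω) c₃ t)) ∧ (∀ s t, i₁ ≤ s → s ≤ j₁ → i₃ ≤ t → t ≤ j₃ → cornerOrbit (if τ₁ then E.bcBondConfig ω else (shiftData E w).bcBondConfig ω) c₁ s ≠ cornerOrbit (if τ₃ then E.bcBondConfig ω else (shiftData E w).bcBondConfig ω) c₃ t) ∧ (∀ s t, i₂ ≤ s → s ≤ j₂ → i₃ ≤ t → t ≤ j₃ → cornerOrbit (if τ₂ then E.bcBondConfig ω else (shiftData E w).bcBondConfig ω) c₂ s ≠ cornerOrbit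 (if τ₃ then E.bcBondConfig ω else (shiftData E w).bcBondConfig ω) c₃ t)) :
    ω ∈ ufrsCert E w z (4 * η) (ρ / 2) := by
  by_cases hnear : X + E.δ ≤ 64 * (4 * η)
  · apply mem_ufrsCert_of_near_W3H
    apply mem_ufrsCertNear_of_strands_W3H
    · rw [mem_ufrsMarkedNbhd_iff]
      obtain ⟨e₀, he₀, hd⟩ := hmarked
      exact ⟨e₀, he₀, by linarith⟩
    · exact ufrsStrands_mono_W3H (by linarith) le_rfl
        (mem_ufrsStrands_two_W3H τ₁ τ₂ c₁ c₂ i₁ j₁ i₂ j₂ (h₁ _ le_rfl) (h₂ _ le_rfl) h₁₂)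
  · rw [not_le] at hnear
    obtain ⟨h₃', h₁₃, h₂₃⟩ := h₃ hnear
    apply mem_ufrsCert_of_marked_W3H
    refine mem_ufrsCertMarked_of_strands_W3H (X := X) (by positivity) (by linarith) hX ?_ ?_ ?_
    · rw [mem_ufrsMarkedNbhd_iff]
      obtain ⟨e₀, he₀, hd⟩ := hmarked
      exact ⟨e₀, he₀, by linarith⟩
    · exact mem_ufrsStrands_three_W3H τ₁ τ₂ τ₃ c₁ c₂ c₃ i₁ j₁ i₂ j₂ i₃ j₃ (h₁ X hX.le) (h₂ X hX.le) h₃' h₁₂ h₁₃ h₂₃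
    · exact mem_ufrsStrands_two_W3H τ₁ τ₂ c₁ c₂ i₁ j₁ i₂ j₂ (h₁ _ le_rfl) (h₂ _ le_rfl) h₁₂

/-- **Three long strands certify** (registered sub-goal `ufrs_certOfThreeLongStrands` of
stmt-CriticalPhenomena-11387; the `∀`-form of `mem_ufrsCert_of_three_far_W3H`): in the UFRS
normalisation `r = 4η`, `R = ρ/2`, outside the escape regime, three pairwise corner-disjoint
simple orbit stretches of either dynamics through the corresponding inner faces, each joining
the `4η`-ball of `z` to distance `ρ/4`, give `ω ∈ ufrsCert E w z (4η) (ρ/2)` (FAR branch). -/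
theorem ufrs_certOfThreeLongStrands : ∀ (E : DiscreteDobrushin) (w : Site 2) (z : ℂ) (η ρ : ℝ) (ω : BondConfig (Site 2)) (τ₁ τ₂ τ₃ : Bool) (c₁ c₂ c₃ : Site 2 × Fin 4) (i₁ j₁ i₂ j₂ i₃ j₃ : ℕ), 0 < η → 256 * (4 * η) ≤ ρ / 2 → (i₁ ≤ j₁ ∧ ((dist (meshPoint E.δ (cornerOrbit (if τ₁ then E.bcBondConfig ω else (shiftData E w).bcBondConfig ω) c₁ i₁).1) z ≤ (4 * η) ∧ (ρ / 2 / 2) ≤ dist (meshPoint E.δ (cornerOrbit (if τ₁ then E.bcBondConfig ω else (shiftData E w).bcBondConfig ω) c₁ j₁).1) z) ∨ ((ρ / 2 / 2) ≤ dist (meshPoint E.δ (cornerOrbit (if τ₁ then E.bcBondConfig ω else (shiftData E w).bcBondConfig ω) c₁ i₁).1) z ∧ dist (meshPoint E.δ (cornerOrbit (if τ₁ then E.bcBondConfig ω else (shiftData E w).bcBondConfig ω) c₁ j₁).1) z ≤ (4 * η))) ∧ (∀ t, i₁ ≤ t → t ≤ j₁ → if τ₁ then E.IsInnerFace (cFace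 (cornerOrbit (if τ₁ then E.bcBondConfig ω else (shiftData E w).bcBondConfig ω) c₁ t)) else (shiftData E w).IsInnerFace (cFace (cornerOrbit (if τ₁ then E.bcBondConfig ω else (shiftData E w).bcBondConfig ω) c₁ t))) ∧ (∀ s t, i₁ ≤ s → s < t → t ≤ j₁ → cornerOrbit (if τ₁ then E.bcBondConfig ω else (shiftData E w).bcBondConfig ω) c₁ s ≠ cornerOrbit (if τ₁ then E.bcBondConfig ω else (shiftData E w).bcBondConfig ω) c₁ t)) → (i₂ ≤ j₂ ∧ ((dist (meshPoint E.δ (cornerOrbit (if τ₂ then E.bcBondConfig ω else (shiftData E w).bcBondConfig ω) c₂ i₂).1) z ≤ (4 * η) ∧ (ρ / 2 / 2) ≤ dist (meshPoint E.δ (cornerOrbit (if τ₂ then E.bcBondConfig ω else (shiftData E w).bcBondConfig ω) c₂ j₂).1) z) ∨ ((ρ / 2 / 2) ≤ dist (meshPoint E.δ (cornerOrbit (if τ₂ then E.bcBondConfig ω else (shiftData E w).bcBondConfig ω) c₂ i₂).1) z ∧ dist (meshPoint E.δ (cornerOrbit (if τ₂ then E.bcBondConfig ω else (shiftData E w).bcBondConfig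 ω) c₂ j₂).1) z ≤ (4 * η))) ∧ (∀ t, i₂ ≤ t → t ≤ j₂ → if τ₂ then E.IsInnerFace (cFace (cornerOrbit (if τ₂ then E.bcBondConfig ω else (shiftData E w).bcBondConfig ω) c₂ t)) else (shiftData E w).IsInnerFace (cFace (cornerOrbit (if τ₂ then E.bcBondConfig ω else (shiftData E w).bcBondConfig ω) c₂ t))) ∧ (∀ s t, i₂ ≤ s → s < t → t ≤ j₂ → cornerOrbit (if τ₂ then E.bcBondConfig ω else (shiftData E w).bcBondConfig ω) c₂ s ≠ cornerOrbit (if τ₂ then E.bcBondConfig ω else (shiftData E w).bcBondConfig ω) c₂ t)) → (i₃ ≤ j₃ ∧ ((dist (meshPoint E.δ (cornerOrbit (if τ₃ then E.bcBondConfig ω else (shiftData E w).bcBondConfig ω) c₃ i₃).1) z ≤ (4 * η) ∧ (ρ / 2 / 2) ≤ dist (meshPoint E.δ (cornerOrbit (if τ₃ then E.bcBondConfig ω else (shiftData E w).bcBondConfig ω) c₃ j₃).1) z) ∨ ((ρ / 2 / 2) ≤ dist (meshPoint E.δ (cornerOrbit (if τ₃ then E.bcBondConfig ω else (shiftData E w).bcBondConfig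 ω) c₃ i₃).1) z ∧ dist (meshPoint E.δ (cornerOrbit (if τ₃ then E.bcBondConfig ω else (shiftData E w).bcBondConfig ω) c₃ j₃).1) z ≤ (4 * η))) ∧ (∀ t, i₃ ≤ t → t ≤ j₃ → if τ₃ then E.IsInnerFace (cFace (cornerOrbit (if τ₃ then E.bcBondConfig ω else (shiftData E w).bcBondConfig ω) c₃ t)) else (shiftData E w).IsInnerFace (cFace (cornerOrbit (if τ₃ then E.bcBondConfig ω else (shiftData E w).bcBondConfig ω) c₃ t))) ∧ (∀ s t, i₃ ≤ s → s < t → t ≤ j₃ → cornerOrbit (if τ₃ then E.bcBondConfig ω else (shiftData E w).bcBondConfig ω) c₃ s ≠ cornerOrbit (if τ₃ then E.bcBondConfig ω else (shiftData E w).bcBondConfig ω) c₃ t)) → (∀ s t, i₁ ≤ s → s ≤ j₁ → i₂ ≤ t → t ≤ j₂ → cornerOrbit (if τ₁ then E.bcBondConfig ω else (shiftData E w).bcBondConfig ω) c₁ s ≠ cornerOrbit (if τ₂ then E.bcBondConfig ω else (shiftData E w).bcBondConfig ω) c₂ t) → (∀ s t, i₁ ≤ s → s ≤ j₁ → i₃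 ≤ t → t ≤ j₃ → cornerOrbit (if τ₁ then E.bcBondConfig ω else (shiftData E w).bcBondConfig ω) c₁ s ≠ cornerOrbit (if τ₃ then E.bcBondConfig ω else (shiftData E w).bcBondConfig ω) c₃ t) → (∀ s t, i₂ ≤ s → s ≤ j₂ → i₃ ≤ t → t ≤ j₃ → cornerOrbit (if τ₂ then E.bcBondConfig ω else (shiftData E w).bcBondConfig ω) c₂ s ≠ cornerOrbit (if τ₃ then E.bcBondConfig ω else (shiftData E w).bcBondConfig ω) c₃ t) → ω ∈ ufrsCert E w z (4 * η) (ρ / 2) :=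
  fun _ _ _ _ _ _ τ₁ τ₂ τ₃ c₁ c₂ c₃ i₁ j₁ i₂ j₂ i₃ j₃ hη hρ h₁ h₂ h₃ h₁₂ h₁₃ h₂₃ =>
    mem_ufrsCert_of_three_far_W3H τ₁ τ₂ τ₃ c₁ c₂ c₃ i₁ j₁ i₂ j₂ i₃ j₃ hη hρ h₁ h₂ h₃ h₁₂ h₁₃ h₂₃

end

end Summit.CriticalPhenomena.CardyFormulaZ2.Cruxes.EdgePrecompact.QkzStripBoundaryArm
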